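import Summits.AtomisticToContinuum.HydrodynamicLimit.Theorems.AntiMazurCoboundariesCorrectorPressureDecayTangentTightnessLaplace
import Literature.Analysis.FluidPDE.HardSphereTorusMeasure
import Literature.Analysis.FunctionSpaces.TorusGridCellsGeometry

/-!
# The canonical local limit, II: density and hard core of the x-averaged blown-up laws (line `FirstLemma`, crux stmt-AtomisticToContinuum-14135)

Helper file of the registered stub `stub_georgiiCanonicalLocalLimit : Georgii1995_hardSphereCanonicalLocalLimit`
(Georgii 1995, equivalence of ensembles on the level of measures), namespace
`Summit.AtomisticToContinuum.HydrodynamicLimit.Theorems.KiferCompactification`: closed finite-`N` pieces of the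
compactness half (E1) `CanonicalBlowUpLocallyCompact` of its decomposition (`…KiferCanonicalLocalLimit.lean`), proved for
the x-averaged blow-up `(dx ⊗ Q) ∘ (blowUp ε)⁻¹` of an ARBITRARY law `Q` on torus configurations (the canonical law
`localGibbsLaw` being the case of the fact):

* `toENNReal_count_blowUp`: on the hard-sphere domain `D_ε` the blown-up configuration has exactly
  `#{i | blowUpPoint ε x zᵢ ∈ S}` points in `S` (the labelled blow-up is injective);
* `lintegral_count_blowUp_window`: averaging over the base point,
  `∫ N_{blowUp ε x z}(B × ℝ³) dx = N · vol(ε B ∩ (-1/2, 1/2]³)` for every configuration `z ∈ D_ε` of `N` spheres —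
  no symmetry of the law of `z` is involved;
* `density_map_blowUp`: for `0 < ε ≤ 1/2` and a probability law `Q` carried by `D_ε`, the DENSITY of the x-averaged
  blown-up law is EXACTLY `N ε³` (`ε [0,1)³` lies in the symmetric cube); for the canonical law of `N + 1` spheres
  of diameter `ε_N = σ (N+1)^{-1/3}`, `σ ≤ 1/2`, this is `σ³` for every `N` (`density_canonicalBlowUp`) — the
  normalisation `density G = σ³` of the named fact is the one inherited by every local limit;
* `ae_isHardCore_map_blowUp`, `ae_isHardCore_canonicalBlowUp`: the x-averaged blown-up laws are carried by
  unit-hard-core configurations; `isProbabilityMeasure_canonicalBlowUp`.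

References: H.-O. Georgii, J. Stat. Phys. 80 (1995), §3; S. Olla, S. R. S. Varadhan, H.-T. Yau, Comm. Math. Phys. 155
(1993) §3–4 (the blow-up).
-/

noncomputable section

open MeasureTheory Set Filter Topology Function
open scoped ENNReal NNReal

namespace Summit.AtomisticToContinuum.HydrodynamicLimit.Theorems.KiferCompactification

open Literature.MathematicalPhysics.KineticTheory (T3 V3 hsDiameter hsDiameter_pos hsDiameter_le localGibbsLaw
  blowUpPoint blowUp succ_mul_hsDiameter_pow_three isProbabilityMeasure_localGibbsLaw)
open Literature.MathematicalPhysics.KineticTheory.PointProcess (density measurable_count_window)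
open Literature.Analysis.FluidPDE (HardSphereFlow Config IsHardCore hardSphereDomain)
open Literature.Analysis.FunctionSpaces (PointConfig)
open Literature.Analysis.FluidPDE.Torus (reprSym symCube measurable_reprSym map_reprSym_volume)
open Literature.Analysis.FunctionSpaces.Torus (unitCube measurableSet_unitCube mem_unitCube volume_unitCube)

variable {N : ℕ}

/-! ## Counting blown-up points -/

/-- On the hard-sphere domain the blown-up configuration has exactly `#{i | blowUpPoint ε x zᵢ ∈ S}` points in `S`
(in `ℝ≥0∞`): the labelled blow-up is injective. -/
theorem toENNReal_count_blowUp {ε : ℝ} (hε : 0 < ε) (x : T3) {z : Config N (Fin 3) T3}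
    (hz : z ∈ hardSphereDomain (Literature.Analysis.FluidPDE.Torus.geometry (Fin 3)) N ε) (S : Set (V3 × V3)) :
    (((blowUp ε x z).count S : ℕ∞) : ℝ≥0∞) = ∑ i, S.indicator (1 : V3 × V3 → ℝ≥0∞) (blowUpPoint ε x (z i)) := by
  classical
  have hinj := injective_blowUpPoint hε x hz
  have hcarrier : (blowUp ε x z).carrier = Set.range fun i => blowUpPoint ε x (z i) := rfl
  have hset : (blowUp ε x z).carrier ∩ S =
      (fun i => blowUpPoint ε x (z i)) '' ((Finset.univ.filter fun i => blowUpPoint ε x (z i) ∈ S : Finset (Fin N)) :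
        Set (Fin N)) := by
    rw [hcarrier, ← Set.image_preimage_eq_range_inter]
    congr 1
    ext i
    simp
  rw [PointConfig.count, hset, hinj.encard_image, Set.encard_coe_eq_coe_finsetCard, ENat.toENNReal_coe,
    Finset.card_filter, Nat.cast_sum]
  refine Finset.sum_congr rfl fun i _ => ?_
  by_cases h : blowUpPoint ε x (z i) ∈ S <;> simp [h]

/-- Measurability in the base point of the window indicator of a blown-up particle. -/
theorem measurableSet_setOf_reprSym_sub_mem (q : T3) {B : Set V3} (hB : MeasurableSet B) :
    MeasurableSet {x : T3 | reprSym (q - x) ∈ B} :=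
  (measurable_reprSym.comp (measurable_const.sub measurable_id)) hB

/-- **Haar measure of reflected minimal-image sets**: `vol {x ∈ 𝕋³ | reprSym (q - x) ∈ B} = vol (B ∩ (-1/2, 1/2]³)`
(`x ↦ q - x` preserves Haar measure; `reprSym` pushes it to Lebesgue measure on the symmetric cube). -/
theorem volume_setOf_reprSym_sub_mem (q : T3) {B : Set V3} (hB : MeasurableSet B) :
    volume {x : T3 | reprSym (q - x) ∈ B} = volume (B ∩ symCube (Fin 3)) := by
  haveI : (volume : Measure T3).IsNegInvariant := Measure.IsAddHaarMeasure.isNegInvariant_of_regular _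
  have h1 : {x : T3 | reprSym (q - x) ∈ B} = (fun x => q - x) ⁻¹' (reprSym ⁻¹' B) := rfl
  rw [h1, (Measure.measurePreserving_sub_left volume q).measure_preimage ((measurable_reprSym hB).nullMeasurableSet),
    ← Measure.map_apply measurable_reprSym hB, map_reprSym_volume, Measure.restrict_apply hB]

/-- **Torus average of window counts of the blow-up.** For `z ∈ D_ε` (`N` spheres) and a measurable `B ⊆ ℝ³`:
`∫_{𝕋³} N_{blowUp ε x z}(B × ℝ³) dx = N · vol(ε B ∩ (-1/2, 1/2]³)` — each particle contributes the Haar measure of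
the base points from which it is seen in `B`. No symmetry of `z` is used. -/
theorem lintegral_count_blowUp_window {ε : ℝ} (hε : 0 < ε) {z : Config N (Fin 3) T3}
    (hz : z ∈ hardSphereDomain (Literature.Analysis.FluidPDE.Torus.geometry (Fin 3)) N ε) {B : Set V3}
    (hB : MeasurableSet B) :
    ∫⁻ x : T3, (((blowUp ε x z).count (Prod.fst ⁻¹' B) : ℕ∞) : ℝ≥0∞) =
      N * volume ((fun y : V3 => ε⁻¹ • y) ⁻¹' B ∩ symCube (Fin 3)) := by
  have hB' : MeasurableSet ((fun y : V3 => ε⁻¹ • y) ⁻¹' B) := (measurable_const_smul ε⁻¹) hB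
  simp_rw [toENNReal_count_blowUp hε _ hz]
  have hterm : ∀ i : Fin N, ∀ x : T3, (Prod.fst ⁻¹' B).indicator (1 : V3 × V3 → ℝ≥0∞) (blowUpPoint ε x (z i)) =
      {x : T3 | reprSym ((z i).1 - x) ∈ (fun y : V3 => ε⁻¹ • y) ⁻¹' B}.indicator 1 x := by
    intro i x
    by_cases h : ε⁻¹ • reprSym ((z i).1 - x) ∈ B
    · rw [Set.indicator_of_mem (show blowUpPoint ε x (z i) ∈ Prod.fst ⁻¹' B from h),
        Set.indicator_of_mem (show x ∈ {x : T3 | reprSym ((z i).1 - x) ∈ (fun y : V3 => ε⁻¹ • y) ⁻¹' B} from h)]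
      rfl
    · rw [Set.indicator_of_notMem (show blowUpPoint ε x (z i) ∉ Prod.fst ⁻¹' B from h),
        Set.indicator_of_notMem (show x ∉ {x : T3 | reprSym ((z i).1 - x) ∈ (fun y : V3 => ε⁻¹ • y) ⁻¹' B} from h)]
  have hmeas : ∀ i : Fin N, MeasurableSet {x : T3 | reprSym ((z i).1 - x) ∈ (fun y : V3 => ε⁻¹ • y) ⁻¹' B} :=
    fun i => measurableSet_setOf_reprSym_sub_mem _ hB'
  rw [lintegral_finsetSum _ fun i _ => ?_]
  · simp_rw [hterm, lintegral_indicator_one (hmeas _), volume_setOf_reprSym_sub_mem _ hB']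
    rw [Finset.sum_const, Finset.card_univ, Fintype.card_fin, nsmul_eq_mul]
  · simp_rw [hterm i]
    exact (measurable_one.indicator (hmeas i))

/-- For `0 < ε ≤ 1/2` the rescaled unit cube `ε [0,1)³` lies in the symmetric cube `(-1/2, 1/2]³`. -/
theorem preimage_smul_unitCube_subset_symCube {ε : ℝ} (hε : 0 < ε) (hε2 : ε ≤ 1 / 2) :
    (fun y : V3 => ε⁻¹ • y) ⁻¹' unitCube (Fin 3) ⊆ symCube (Fin 3) := by
  intro y hy i
  have h := (mem_unitCube.1 hy) i
  simp only [PiLp.smul_apply, smul_eq_mul] at h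
  have h0 : 0 ≤ y i := by
    by_contra hlt
    push Not at hlt
    have : ε⁻¹ * y i < 0 := mul_neg_of_pos_of_neg (inv_pos.2 hε) hlt
    linarith [h.1]
  have h1 : y i < ε := by
    have h2 := h.2
    rwa [inv_mul_lt_iff₀ hε, mul_one] at h2
  constructor <;> linarith

/-- The rescaled unit cube `ε [0,1)³` has volume `ε³`. -/
theorem volume_preimage_smul_unitCube {ε : ℝ} (hε : 0 < ε) :
    volume ((fun y : V3 => ε⁻¹ • y) ⁻¹' unitCube (Fin 3)) = ENNReal.ofReal (ε ^ 3) := by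
  rw [Measure.addHaar_preimage_smul volume (inv_ne_zero hε.ne') (unitCube (Fin 3)), volume_unitCube, mul_one,
    finrank_euclideanSpace_fin, inv_pow, inv_inv, abs_of_pos (pow_pos hε 3)]

/-! ## Density of the x-averaged blown-up laws -/

/-- **Density of the x-averaged blow-up.** For `0 < ε ≤ 1/2` and a probability law `Q` on configurations of `N` torus
particles carried by the hard-sphere domain `D_ε`, the density (mean number of points with position in `[0,1)³`) of
the law of `blowUp ε x z` under `dx ⊗ Q` is exactly `N ε³`. -/
theorem density_map_blowUp {ε : ℝ} (hε : 0 < ε) (hε2 : ε ≤ 1 / 2) (Q : Measure (Config N (Fin 3) T3))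
    [IsProbabilityMeasure Q]
    (hQ : ∀ᵐ z ∂Q, z ∈ hardSphereDomain (Literature.Analysis.FluidPDE.Torus.geometry (Fin 3)) N ε) :
    density (((volume : Measure T3).prod Q).map fun p => blowUp ε p.1 p.2) = ENNReal.ofReal (N * ε ^ 3) := by
  haveI : IsProbabilityMeasure (volume : Measure T3) := by rw [volume_pi]; infer_instance
  have hcnt : Measurable fun ω : PointConfig (V3 × V3) =>
      ((ω.count (Prod.fst ⁻¹' unitCube (Fin 3)) : ℕ∞) : ℝ≥0∞) :=
    measurable_count_window measurableSet_unitCube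
  have hmeas : Measurable fun p : T3 × Config N (Fin 3) T3 =>
      (((blowUp ε p.1 p.2).count (Prod.fst ⁻¹' unitCube (Fin 3)) : ℕ∞) : ℝ≥0∞) :=
    hcnt.comp (measurable_blowUp ε N)
  rw [Literature.MathematicalPhysics.KineticTheory.PointProcess.density,
    lintegral_map hcnt (measurable_blowUp ε N), lintegral_prod_symm _ hmeas.aemeasurable]
  have hae : ∀ᵐ z ∂Q, ∫⁻ x : T3, (((blowUp ε x z).count (Prod.fst ⁻¹' unitCube (Fin 3)) : ℕ∞) : ℝ≥0∞) =
      ENNReal.ofReal (N * ε ^ 3) := by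
    filter_upwards [hQ] with z hz
    rw [lintegral_count_blowUp_window hε hz measurableSet_unitCube,
      Set.inter_eq_left.2 (preimage_smul_unitCube_subset_symCube hε hε2), volume_preimage_smul_unitCube hε,
      ENNReal.ofReal_mul (Nat.cast_nonneg _), ENNReal.ofReal_natCast]
  rw [lintegral_congr_ae hae, lintegral_const, measure_univ, mul_one]

/-- The canonical law of `N + 1` hard spheres is carried by the hard-sphere domain `D_{ε_N}`. -/
theorem ae_mem_hardSphereDomain_localGibbsLaw (σ : ℝ) (a₀ θ₀ : T3 → ℝ) (u₀ : T3 → V3) (N : ℕ)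
    (Φ : HardSphereFlow (Literature.Analysis.FluidPDE.Torus.geometry (Fin 3)) (hsDiameter σ N) (N + 1)) :
    ∀ᵐ z ∂(localGibbsLaw σ a₀ u₀ θ₀ N Φ),
      z ∈ hardSphereDomain (Literature.Analysis.FluidPDE.Torus.geometry (Fin 3)) (N + 1) (hsDiameter σ N) := by
  have hac : localGibbsLaw σ a₀ u₀ θ₀ N Φ ≪ Literature.Analysis.FluidPDE.liouville
      (Literature.Analysis.FluidPDE.Torus.geometry (Fin 3)) (N + 1) (hsDiameter σ N) := by
    rw [Literature.MathematicalPhysics.KineticTheory.localGibbsLaw_eq]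
    exact Literature.MathematicalPhysics.KineticTheory.localGibbsMeasure_absolutelyContinuous σ _ _ _ N Φ
  exact hac.ae_le (ae_restrict_mem (Literature.Analysis.FluidPDE.measurableSet_hardSphereDomain _
    Literature.Analysis.FluidPDE.Torus.measurable_geometry_sepVec _ _))

/-- **The x-averaged blown-up canonical law has density exactly `σ³`** for every `N` (`0 < σ ≤ 1/2`, constant profiles
`a, θ > 0`): `(N+1) ε_N³ = σ³` and `ε_N ≤ σ ≤ 1/2`. This is the finite-`N` side of the clause
`density G = ENNReal.ofReal (σ ^ 3)` of `Georgii1995_hardSphereCanonicalLocalLimit`. -/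
theorem density_canonicalBlowUp : ∀ (σ a θ : ℝ) (u₀ : V3), 0 < σ → σ ≤ 1 / 2 → 0 < a → 0 < θ →
    ∀ (N : ℕ) (Φ : HardSphereFlow (Literature.Analysis.FluidPDE.Torus.geometry (Fin 3)) (hsDiameter σ N) (N + 1)),
    density (((volume : Measure T3).prod (localGibbsLaw σ (fun _ => a) (fun _ => u₀) (fun _ => θ) N Φ)).map
      (fun p => blowUp (hsDiameter σ N) p.1 p.2)) = ENNReal.ofReal (σ ^ 3) := by
  intro σ a θ u₀ hσ hσ2 ha hθ N Φ
  haveI := isProbabilityMeasure_localGibbsLaw (a₀ := fun _ => a) (θ₀ := fun _ => θ) (u₀ := fun _ => u₀)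
    continuous_const continuous_const continuous_const (fun _ => ha) (fun _ => hθ) hσ2 N Φ
  rw [density_map_blowUp (hsDiameter_pos hσ N) ((hsDiameter_le hσ.le N).trans hσ2) _
    (ae_mem_hardSphereDomain_localGibbsLaw σ _ _ _ N Φ), succ_mul_hsDiameter_pow_three]

/-! ## Hard core and total mass -/

/-- The x-averaged blow-up of a law carried by the hard-sphere domain `D_ε` (`ε > 0`) is carried by unit-hard-core
configurations. -/
theorem ae_isHardCore_map_blowUp {ε : ℝ} (hε : 0 < ε) (Q : Measure (Config N (Fin 3) T3))
    (hQ : ∀ᵐ z ∂Q, z ∈ hardSphereDomain (Literature.Analysis.FluidPDE.Torus.geometry (Fin 3)) N ε) :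
    ∀ᵐ ω ∂(((volume : Measure T3).prod Q).map fun p => blowUp ε p.1 p.2), IsHardCore 1 ω := by
  rw [ae_map_iff (measurable_blowUp ε N).aemeasurable (measurableSet_setOf_isHardCore 1)]
  have hae : ∀ᵐ p ∂((volume : Measure T3).prod Q),
      p.2 ∈ hardSphereDomain (Literature.Analysis.FluidPDE.Torus.geometry (Fin 3)) N ε :=
    (Measure.quasiMeasurePreserving_snd).ae hQ
  filter_upwards [hae] with p hp using stub_isHardCore_blowUp hε p.1 hp

/-- **The x-averaged blown-up canonical laws are carried by unit-hard-core configurations.** -/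
theorem ae_isHardCore_canonicalBlowUp {σ : ℝ} (hσ : 0 < σ) (a θ : ℝ) (u₀ : V3) (N : ℕ)
    (Φ : HardSphereFlow (Literature.Analysis.FluidPDE.Torus.geometry (Fin 3)) (hsDiameter σ N) (N + 1)) :
    ∀ᵐ ω ∂(((volume : Measure T3).prod (localGibbsLaw σ (fun _ => a) (fun _ => u₀) (fun _ => θ) N Φ)).map
      fun p => blowUp (hsDiameter σ N) p.1 p.2), IsHardCore 1 ω := by
  exact ae_isHardCore_map_blowUp (hsDiameter_pos hσ N) _ (ae_mem_hardSphereDomain_localGibbsLaw σ _ _ _ N Φ)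

/-- **The x-averaged blown-up canonical law is a probability law** (`σ ≤ 1/2`, `a, θ > 0`). -/
theorem isProbabilityMeasure_canonicalBlowUp {σ a θ : ℝ} (u₀ : V3) (hσ2 : σ ≤ 1 / 2) (ha : 0 < a) (hθ : 0 < θ)
    (N : ℕ) (Φ : HardSphereFlow (Literature.Analysis.FluidPDE.Torus.geometry (Fin 3)) (hsDiameter σ N) (N + 1)) :
    IsProbabilityMeasure (((volume : Measure T3).prod (localGibbsLaw σ (fun _ => a) (fun _ => u₀) (fun _ => θ) N Φ)).map
      fun p => blowUp (hsDiameter σ N) p.1 p.2) := by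
  haveI : IsProbabilityMeasure (volume : Measure T3) := by rw [volume_pi]; infer_instance
  haveI := isProbabilityMeasure_localGibbsLaw (a₀ := fun _ => a) (θ₀ := fun _ => θ) (u₀ := fun _ => u₀)
    continuous_const continuous_const continuous_const (fun _ => ha) (fun _ => hθ) hσ2 N Φ
  exact Measure.isProbabilityMeasure_map (measurable_blowUp _ _).aemeasurable

end Summit.AtomisticToContinuum.HydrodynamicLimit.Theorems.KiferCompactification

end
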